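import Summits.ABC.IUTFork.Joshi.ArchimedeanOstrowskiComplete
import Summits.ABC.IUTFork.Joshi.ArchimedeanOstrowskiProp231Holds
import Mathlib.NumberTheory.NumberField.InfinitePlace.Embeddings

/-!
# [J-II½] Def. 2.3.2 characterised intrinsically: «archimedean algebraically closed perfectoid field» ⟺ complete
# archimedean Bourbaki valued field in which `-1` is a square (proof-only; DERIVED remark, not a claim of print)

Proof-only companion file of the abc-iut cell, branch E «type Joshi's construction, test vs S» (rung LADDER-ABC:A2.E;
seat abc-iut-E-t38, gen 4; lineage slot T-38 = [J-II½] arXiv:2305.10398v12 §2.3). SOURCE: K. Joshi, *Construction of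
Arithmetic Teichmüller Spaces II½*, arXiv:2305.10398**v12** (UNREFEREED; bib `Joshi2023ATS2half`), Def. 2.3.2, p.12 l.13–15
of the render `HOME/plan/repair/lit/renders/Joshi-arxiv-2305.10398-ATS2half/`: «An archimedean algebraically closed
perfectoid field is a valued field (K, |−|_K) which is isomorphic with (ℂ, |−|^s_ℂ) for some s ∈ ℝ_{>0}» — typed by slot T-38
as `ATS2half.IsArchPerfectoid abs := ∃ s > 0, ∃ e : K ≃+* ℂ, ∀ x, abs x = powAbs s (e x)` (`Joshi/ArchimedeanUntiltsJoshi.lean`,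
p432383). Print DEFINES the notion by reference to `ℂ`; this file records, as a DERIVED REMARK in kernel (Ostrowski's
theorem, complete case: `ArchimedeanOstrowski.exists_ringEquiv_complex_of_completeSpace_of_sq_eq_neg_one`, p448762), that
the definition is INTRINSIC:

* `isArchPerfectoid_iff_complete` — `IsArchPerfectoid abs` **iff** `abs` is an archimedean valued-field structure in
  Bourbaki's sense (`ATS2half.IsArchimedeanAbs`, Prop. 2.3.1's hypothesis), `-1` is a square in `K`, and `K` is complete for
  (some, equivalently any, positive power of `abs` which is) an absolute value — completeness being expressed through
  Mathlib's `CompleteSpace (WithAbs v)` for an `AbsoluteValue` model `v = abs^t` (such models exist by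
  `ATS2half.absoluteValue_of_isArchimedeanAbs`, p448268);
* the two directions separately: `isArchPerfectoid_of_completeSpace`, `IsArchPerfectoid.isArchimedeanAbs`,
  `IsArchPerfectoid.exists_sq_eq_neg_one`, `IsArchPerfectoid.exists_completeSpace_model`.

So «algebraically closed» in the name of Def. 2.3.2 is automatic (`≅ ℂ`), and what the definition selects among archimedean
valued fields is COMPLETENESS (e.g. `(ℚ̄ ∩ ℂ, |−|)` or `(ℂ, |ι(−)|)` for a non-surjective self-embedding `ι` are archimedean,
contain `√-1`, and are not archimedean perfectoid). A dictionary remark for the E-lit NOTATION table / FAITHFULNESS FLAG (F2);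
**no side is taken** on [IUTchIII] Cor. 3.12 or on any author; typed ≠ proved; no new claim, no `def`, no hypothesis
`Prop`, nothing of the cell's frozen interface imported. Standard axioms only; sorry-free. bears_on: LADDER-ABC:A2.E
-/

set_option autoImplicit false

noncomputable section

namespace Summit.ABC.IUTFork.Joshi.ATS2half

open Summit.ABC.IUTFork.Joshi.ATS2h (IsValuedField)
open Summit.ABC.IUTFork.Joshi.ArchimedeanOstrowski

universe u

variable {K : Type u} [Field K]

/-- **Def. 2.3.2 ⟸ completeness.** A Bourbaki archimedean valued field `(K, abs)` in which `-1` is a square and which is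
complete for an absolute-value model `v = abs^t` (`t > 0`) is an archimedean algebraically closed perfectoid field in
Joshi's sense: `(K, abs) ≅ (ℂ, |−|^s_ℂ)`. [folklore] -/
theorem isArchPerfectoid_of_completeSpace {abs : K → ℝ} (habs : IsArchimedeanAbs abs) (v : AbsoluteValue K ℝ)
    {t : ℝ} (ht : 0 < t) (hv : ∀ x, v x = abs x ^ t) [CompleteSpace (WithAbs v)] {i : K} (hi : i ^ 2 = -1) :
    IsArchPerfectoid abs := by
  have h0 : ∀ x, 0 ≤ abs x := habs.1.nonneg
  -- `v` is not non-archimedean (else `abs = v^{1/t}` would be)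
  have hna : ¬ IsNonarchimedean v := by
    intro hnon
    refine habs.2 fun x y => ?_
    have hxy : v (x + y) ≤ max (v x) (v y) := hnon x y
    rw [hv, hv, hv] at hxy
    calc abs (x + y) = (abs (x + y) ^ t) ^ t⁻¹ := (Real.rpow_rpow_inv (h0 _) ht.ne').symm
      _ ≤ (max (abs x ^ t) (abs y ^ t)) ^ t⁻¹ :=
          Real.rpow_le_rpow (Real.rpow_nonneg (h0 _) t) hxy (inv_nonneg.mpr ht.le)
      _ ≤ max ((abs x ^ t) ^ t⁻¹) ((abs y ^ t) ^ t⁻¹) := max_rpow_le_max_rpow _ _ _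
      _ = max (abs x) (abs y) := by rw [Real.rpow_rpow_inv (h0 _) ht.ne', Real.rpow_rpow_inv (h0 _) ht.ne']
  obtain ⟨s, hs, -, e, he⟩ := exists_ringEquiv_complex_of_completeSpace_of_sq_eq_neg_one v hna hi
  refine ⟨s * t⁻¹, mul_pos hs (inv_pos.mpr ht), e, fun x => ?_⟩
  calc abs x = (abs x ^ t) ^ t⁻¹ := (Real.rpow_rpow_inv (h0 _) ht.ne').symm
    _ = (‖e x‖ ^ s) ^ t⁻¹ := by rw [← hv, he]
    _ = powAbs (s * t⁻¹) (e x) := by rw [powAbs_apply, Real.rpow_mul (norm_nonneg _)]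

/-- **Def. 2.3.2 ⟹ archimedean** (Bourbaki valued field, not non-archimedean: at `1 + 1`). [folklore] -/
theorem IsArchPerfectoid.isArchimedeanAbs {abs : K → ℝ} (h : IsArchPerfectoid abs) : IsArchimedeanAbs abs := by
  refine ⟨h.isValuedField, fun hnon => ?_⟩
  obtain ⟨s, hs, e, he⟩ := h
  have h2 := hnon 1 1
  rw [he, he, map_add, map_one, powAbs_apply, powAbs_apply, norm_one, Real.one_rpow, max_self] at h2
  have h12 : (1 : ℂ) + 1 = 2 := by norm_num
  rw [h12, Complex.norm_ofNat] at h2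
  exact absurd h2 (not_le.mpr (Real.one_lt_rpow one_lt_two hs))

/-- **Def. 2.3.2 ⟹ `-1` is a square** (pull back `I`). [folklore] -/
theorem IsArchPerfectoid.exists_sq_eq_neg_one {abs : K → ℝ} (h : IsArchPerfectoid abs) : ∃ i : K, i ^ 2 = -1 := by
  obtain ⟨s, -, e, -⟩ := h
  refine ⟨e.symm Complex.I, e.injective ?_⟩
  rw [map_pow, e.apply_symm_apply, Complex.I_sq, map_neg, map_one]

/-- **Def. 2.3.2 ⟹ complete** for the absolute-value model `‖e(·)‖ = abs^{1/s}`: the model is isometric to `ℂ`.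
[folklore] -/
theorem IsArchPerfectoid.exists_completeSpace_model {abs : K → ℝ} (h : IsArchPerfectoid abs) :
    ∃ (v : AbsoluteValue K ℝ) (t : ℝ), 0 < t ∧ (∀ x, v x = abs x ^ t) ∧ CompleteSpace (WithAbs v) := by
  obtain ⟨s, hs, e, he⟩ := h
  let v : AbsoluteValue K ℝ := NumberField.place (e : K →+* ℂ)
  have hv : ∀ x, v x = ‖e x‖ := fun x => by
    show ‖(e : K →+* ℂ) x‖ = ‖e x‖
    rw [RingHom.coe_coe]
  refine ⟨v, s⁻¹, inv_pos.mpr hs, fun x => ?_, ?_⟩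
  · rw [hv, he, powAbs_apply, Real.rpow_rpow_inv (norm_nonneg _) hs.ne']
  · -- `WithAbs v → ℂ`, `a ↦ e (ofAbs a)`, is a surjective isometry
    let j : WithAbs v →+* ℂ := (e : K →+* ℂ).comp (WithAbs.equiv v).toRingHom
    have hj : ∀ a, ‖j a‖ = ‖a‖ := fun a => by
      show ‖(e : K →+* ℂ) (WithAbs.ofAbs a)‖ = ‖a‖
      rw [WithAbs.norm_eq_apply_ofAbs, hv, RingHom.coe_coe]
    have hiso : Isometry j := AddMonoidHomClass.isometry_of_norm j hj
    have hsurj : Function.Surjective j := fun z =>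
      ⟨WithAbs.toAbs v (e.symm z), by
        show (e : K →+* ℂ) (WithAbs.ofAbs (WithAbs.toAbs v (e.symm z))) = z
        rw [WithAbs.ofAbs_toAbs, RingHom.coe_coe, e.apply_symm_apply]⟩
    exact (hiso.isUniformInducing.completeSpace_congr hsurj).mpr inferInstance

/-- **Def. 2.3.2, intrinsic form.** `(K, abs)` is an archimedean algebraically closed perfectoid field in Joshi's sense
(isomorphic to some `(ℂ, |−|^s_ℂ)`) **iff** `abs` is an archimedean Bourbaki valuation, `-1` is a square in `K`, and `K` is
complete for some absolute-value model `v = abs^t`, `t > 0`. [folklore] -/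
theorem isArchPerfectoid_iff_complete (abs : K → ℝ) :
    IsArchPerfectoid abs ↔ IsArchimedeanAbs abs ∧ (∃ i : K, i ^ 2 = -1) ∧
      ∃ (v : AbsoluteValue K ℝ) (t : ℝ), 0 < t ∧ (∀ x, v x = abs x ^ t) ∧ CompleteSpace (WithAbs v) := by
  constructor
  · intro h
    exact ⟨h.isArchimedeanAbs, h.exists_sq_eq_neg_one, h.exists_completeSpace_model⟩
  · rintro ⟨habs, ⟨i, hi⟩, v, t, ht, hv, hc⟩
    exact isArchPerfectoid_of_completeSpace habs v ht hv hi

end Summit.ABC.IUTFork.Joshi.ATS2half
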